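import Summits.AnomalousDissipation.AnomalousDissipation.Theorems.SolenoidalFractalHomogenisationLagrangianStepVmodFsShortWindow
import Summits.AnomalousDissipation.AnomalousDissipation.Theorems.SolenoidalFractalHomogenisationLagrangianStepVmodFsPhaseWindow
import HarnessLib

/-!
# K1L_D (stmt-AnomalousDissipation-27980), (V_mod) flat stage (ℓ2), (fs) block: the MEAN of the slow test decouples (both members conserve the
# mean and the fast datum has none), and the (fs) bounds for slow tests WITH mean (prover ad-k1loc-p3 g10, `--supports 27980 --as helper`)

* `fs_inner_eq_inner_slowNZ` — for `x` fast and `ζ` slow, `⟪U s t x − T s t x, ζ⟫ = ⟪U s t x − T s t x, ζ − P₀ζ⟫` with `ζ − P₀ζ` slow WITHOUT mean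
  and `q*_T(ζ − P₀ζ) ≤ q*_T(ζ)` (`fc_apply_zero_eq`: `𝓕(U x)(0) = 𝓕x(0) = 0`, same for `T`; orthogonal split of the adjoint loss, `coarseSupp`);
* `fs_pairing_le_of_phase_window_slow` — `…VmodFsPhaseWindow.fs_pairing_le_of_phase_window` (p713747) for every slow test (`IsSlow`), same constant.
(`…VmodFsShortWindow.fs_pairing_le_of_short_window`, p712752, is already stated for `IsSlow`.)  So at carrier phase 0 the (fs) pairing is bounded in loss
currency on ALL windows for fast data and slow tests: `≤ max(νΛ(k + hiΛ + β)/(c·lo), 2√(η_u² + 2))·√q_T(x)·√q*_T(ζ)` (`fs_pairing_le_at_phase_zero`).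
NOT a proof of `Bfs_textEVH` (its allowance DECAYS for τ ≫ P and it quantifies over every phase `s`), of `stub_Vmod_EHT`, of K1L_D or of AD; rung F-D1.A0.
-/

set_option linter.dupNamespace false

noncomputable section

namespace Summit.AnomalousDissipation.AnomalousDissipation.Theorems.SolenoidalFractalHomogenisation.LagrangianStep.VmodFlat

open Literature.Analysis Literature.Analysis.FluidPDE Literature.Analysis.FunctionSpaces
open MeasureTheory Set Filter UnitAddTorus
open scoped ENNReal NNReal InnerProductSpace
open Summit.AnomalousDissipation.AnomalousDissipation.Theorems.SolenoidalFractalHomogenisation.LagrangianStep.CellClauseMod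
open Summit.AnomalousDissipation.AnomalousDissipation.Theorems.SolenoidalFractalHomogenisation.LagrangianStep.LossCurrency
open Summit.AnomalousDissipation.AnomalousDissipation.Theorems.SolenoidalFractalHomogenisation.RealisedQuasiStaticCellLaw
  (isSmooth_cell isDivFree_cell memLp_top_stLift_cell)

set_option maxHeartbeats 1600000 in
/-- **The mean of a slow test decouples from the (fs) pairing**: for `x` fast and `ζ` slow there is a slow test WITHOUT mean `ζ'` (`= ζ − P₀ζ`) with the
same pairing and no larger adjoint loss. -/
theorem fs_inner_eq_inner_slowNZ {k : ℕ} (W : LatticeShear.LatticeWord k) (M : ℝ) (hM : 0 < M) {c : ℝ} (hc : 0 < c)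
    (Φ : ℝ → Torus.Visc4 (Fin 3) → Torus.Visc4 (Fin 3)) {lo hi Λ ν₀ K : ℝ} (hlo : 0 < lo) (hΛ : 1 < Λ) (hK : 0 < K)
    {ν : ℝ} (hν : ν ∈ Set.Ioo 0 ν₀) {n : ℕ} (hn : (⌈K / ν⌉₊ : ℝ) ≤ n) {𝔸 : Torus.Visc4 (Fin 3)}
    (hwin : ∃ lam ∈ Set.Icc (1:ℝ) Λ, Torus.NearIso 𝔸 (ν * (lo / lam)) (ν * (hi * lam)))
    (hΦw : ∃ lam ∈ Set.Icc (1:ℝ) Λ, Torus.NearIso (Φ ν ((1 / ν) • 𝔸)) (lo / lam) (hi * lam))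
    {Tw : ℝ} {U T : ℝ → ℝ → (V2 →L[ℝ] V2)}
    (hU : Torus.IsPropagator Tw (cellField W M hM ν hν.1 n) ((1 / (n:ℝ) ^ 2) • 𝔸) U)
    (hT : Torus.IsPropagator Tw (fun _ _ => 0) ((1 / (n:ℝ) ^ 2) • (𝔸 + (c / ν) • Φ ν ((1 / ν) • 𝔸))) T)
    {s t : ℝ} (hs : 0 ≤ s) (hst : s < t) (htT : t ≤ Tw) (x ζ : V2) (hx : IsFast n x) (hζ : IsSlow n ζ) :
    ∃ ζ' : V2, IsSlowNZ n ζ' ∧ ⟪U s t x - T s t x, ζ⟫_ℝ = ⟪U s t x - T s t x, ζ'⟫_ℝ ∧ lossAdj (T s t) ζ' ≤ lossAdj (T s t) ζ := by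
  have hn1 : (1:ℝ) ≤ n := by
    have h1 : (1:ℝ) ≤ ⌈K / ν⌉₊ := by
      have : 0 < K / ν := div_pos hK hν.1
      exact_mod_cast Nat.one_le_iff_ne_zero.2 (Nat.pos_iff_ne_zero.1 (Nat.ceil_pos.2 this))
    exact h1.trans hn
  have hnpos : 0 < n := by exact_mod_cast (show (0:ℝ) < n by linarith)
  have hΛ0 : 0 < Λ := by linarith
  obtain ⟨lam, hlam, hA𝔸⟩ := hwin
  obtain ⟨lam', hlam', hΦn⟩ := hΦw
  have hlam0 : 0 < lam := by linarith [hlam.1]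
  have hlam'0 : 0 < lam' := by linarith [hlam'.1]
  have hcν : 0 ≤ c / ν := div_nonneg hc.le hν.1.le
  have hn2 : (0:ℝ) < 1 / (n:ℝ) ^ 2 := by positivity
  have hcell : Torus.NearIso ((1 / (n:ℝ) ^ 2) • 𝔸) ((1 / (n:ℝ) ^ 2) * (ν * (lo / lam))) ((1 / (n:ℝ) ^ 2) * (ν * (hi * lam))) :=
    hA𝔸.smul hn2.le
  have hcell_lo : 0 < (1 / (n:ℝ) ^ 2) * (ν * (lo / lam)) := mul_pos hn2 (mul_pos hν.1 (div_pos hlo hlam0))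
  have hcoarse : Torus.NearIso ((1 / (n:ℝ) ^ 2) • (𝔸 + (c / ν) • Φ ν ((1 / ν) • 𝔸)))
      ((1 / (n:ℝ) ^ 2) * (ν * (lo / lam) + (c / ν) * (lo / lam'))) ((1 / (n:ℝ) ^ 2) * (ν * (hi * lam) + (c / ν) * (hi * lam'))) :=
    (hA𝔸.add (hΦn.smul hcν)).smul hn2.le
  have hcoarse_lo : 0 < (1 / (n:ℝ) ^ 2) * (ν * (lo / lam) + (c / ν) * (lo / lam')) := by
    have h1 : 0 < ν * (lo / lam) := mul_pos hν.1 (div_pos hlo hlam0)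
    have h2 : 0 ≤ (c / ν) * (lo / lam') := mul_nonneg hcν (div_pos hlo hlam'0).le
    exact mul_pos hn2 (by linarith)
  have hbU : MemLp (Torus.stLift (cellField W M hM ν hν.1 n)) ∞ (volume.restrict (Ioo 0 Tw ×ˢ (univ : Set (EuclideanSpace ℝ (Fin 3))))) :=
    memLp_top_stLift_cell _ n Tw
  have hbUdiv : ∀ᵐ τ ∂(volume.restrict (Ioo (0:ℝ) Tw)), Torus.IsWeaklyDivFree (cellField W M hM ν hν.1 n τ) :=
    ae_of_all _ fun τ => (isDivFree_cell _ n τ).isWeaklyDivFree_holds (isSmooth_cell _ n τ)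
  have hsupp := coarseSupp Tw _ _ _ hcoarse_lo hcoarse T hT s t hs hst.le htT
  -- the split of the test at the zero mode
  set A0 : Set (Fin 3 → ℤ) := {0} with hA0
  obtain ⟨P0, hP0⟩ := exists_labelProj A0 (fun k' => by rw [hA0]; simp)
  have hP0on : ∀ y : V2, fc (P0 y) 0 = fc y 0 := fun y => by have h := hP0 y 0; rw [if_pos (by rw [hA0]; simp)] at h; exact h
  have hP0off : ∀ (y : V2) k', k' ≠ 0 → fc (P0 y) k' = 0 := fun y k' hk' => by
    have h := hP0 y k'; rw [if_neg (by rw [hA0]; simpa using hk')] at h; exact h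
  set ζ₀ : V2 := P0 ζ with hζ₀
  set ζ' : V2 := ζ - P0 ζ with hζ'
  have hζsplit : ζ = ζ₀ + ζ' := by rw [hζ₀, hζ']; abel
  have hζ'nz : IsSlowNZ n ζ' := by
    intro k' hk'
    rw [fc_sub]
    by_cases h0 : k' = 0
    · subst h0; rw [hP0on, sub_self]
    · rw [hP0off ζ k' h0, sub_zero]
      exact hζ k' fun hmem => hk' (Finset.mem_erase.2 ⟨h0, hmem⟩)
  have hζ'0 : fc ζ' 0 = 0 := hζ'nz 0 (by simp)
  -- the zero mode of `U x − T x` vanishes: the fast datum has no mean and both members conserve it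
  have hx0 : fc x 0 = 0 := hx 0 (by rw [Torus.mem_freqBall]; simp [Torus.freqNormSq])
  have hU0 : fc (U s t x) 0 = 0 := by rw [fc_apply_zero_eq hcell hcell_lo hbU hbUdiv hU hs hst.le htT x, hx0]
  have hT0 : fc (T s t x) 0 = 0 := (hsupp x 0 hx0).1
  have hdiff0 : fc (U s t x - T s t x) 0 = 0 := by rw [fc_sub, hU0, hT0, sub_self]
  refine ⟨ζ', hζ'nz, ?_, ?_⟩
  · rw [hζsplit, inner_add_right]
    have hz : ⟪U s t x - T s t x, ζ₀⟫_ℝ = 0 := by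
      refine inner_eq_zero_of_fc_disjoint fun k' => ?_
      by_cases h0 : k' = 0
      · subst h0; exact Or.inl hdiff0
      · exact Or.inr (hP0off ζ k' h0)
    rw [hz, zero_add]
  · have hTc : ∀ y, ‖T s t y‖ ≤ ‖y‖ := hT.norm_le s t
    have hoζ : ⟪ζ₀, ζ'⟫_ℝ = 0 := inner_eq_zero_of_fc_disjoint fun k' => by
      by_cases h0 : k' = 0
      · subst h0; exact Or.inr hζ'0
      · exact Or.inl (hP0off ζ k' h0)
    have hoAζ : ⟪ContinuousLinearMap.adjoint (T s t) ζ₀, ContinuousLinearMap.adjoint (T s t) ζ'⟫_ℝ = 0 :=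
      inner_eq_zero_of_fc_disjoint fun k' => by
        by_cases h0 : k' = 0
        · subst h0; exact Or.inr ((hsupp ζ' 0 hζ'0).2)
        · exact Or.inl ((hsupp ζ₀ k' (hP0off ζ k' h0)).2)
    have hadd : lossAdj (T s t) ζ = lossAdj (T s t) ζ₀ + lossAdj (T s t) ζ' := by
      unfold lossAdj; rw [hζsplit]; exact loss_add_of_orthogonal hoζ hoAζ
    have h0 : 0 ≤ lossAdj (T s t) ζ₀ := lossAdj_nonneg hTc ζ₀
    rw [hadd]; linarith

/-- **(fs) at carrier phase 0 beyond the fast saturation time, for EVERY slow test** (with mean): the bound of `fs_pairing_le_of_phase_window`. -/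
theorem fs_pairing_le_of_phase_window_slow {k : ℕ} (W : LatticeShear.LatticeWord k) (M : ℝ) (hM : 0 < M) {c : ℝ} (hc : 0 < c)
    (Φ : ℝ → Torus.Visc4 (Fin 3) → Torus.Visc4 (Fin 3)) {lo hi Λ β ν₀ K : ℝ}
    (hlo : 0 < lo) (hhi : 1 ≤ hi) (hΛ : 1 < Λ) (hβ : 0 ≤ β) (hν₀ : ν₀ ≤ 1) (hK : 0 < K)
    {ν : ℝ} (hν : ν ∈ Set.Ioo 0 ν₀) {n : ℕ} (hn : (⌈K / ν⌉₊ : ℝ) ≤ n) {𝔸 : Torus.Visc4 (Fin 3)}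
    (hodd : Torus.OddSmall 𝔸 (ν * β)) (hwin : ∃ lam ∈ Set.Icc (1:ℝ) Λ, Torus.NearIso 𝔸 (ν * (lo / lam)) (ν * (hi * lam)))
    (hΦw : ∃ lam ∈ Set.Icc (1:ℝ) Λ, Torus.NearIso (Φ ν ((1 / ν) • 𝔸)) (lo / lam) (hi * lam))
    {Tw : ℝ} {U T : ℝ → ℝ → (V2 →L[ℝ] V2)}
    (hU : Torus.IsPropagator Tw (cellField W M hM ν hν.1 n) ((1 / (n:ℝ) ^ 2) • 𝔸) U)
    (hT : Torus.IsPropagator Tw (fun _ _ => 0) ((1 / (n:ℝ) ^ 2) • (𝔸 + (c / ν) • Φ ν ((1 / ν) • 𝔸))) T)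
    {s t : ℝ} (hs : 0 ≤ s) (hst : s < t) (htT : t ≤ Tw)
    (hphase : ∀ τ, cellField W M hM ν hν.1 n (s + τ) = cellField W M hM ν hν.1 n τ)
    (x ζ : V2) (hx : IsFast n x) (hζ : IsSlow n ζ)
    (hsat : 1 ≤ 8 * Real.pi ^ 2 * loT lo Λ c ν n * ((n / 4 : ℕ) : ℝ) ^ 2 * (t - s)) :
    |⟪U s t x - T s t x, ζ⟫_ℝ|
      ≤ 2 * Real.sqrt (3 * k * (3 * k + Real.pi ^ 2 * (hi * Λ + β / 2)) * Λ ^ 2 * Real.exp (9 * (k:ℝ) ^ 2 * Λ ^ 2 / (4 * Real.pi ^ 4 * c * lo ^ 2))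
            / (Real.pi ^ 4 * c * lo ^ 2) + 2)
          * Real.sqrt (lossFwd (T s t) x) * Real.sqrt (lossAdj (T s t) ζ) := by
  obtain ⟨ζ', hζ', hpair, hloss⟩ := fs_inner_eq_inner_slowNZ W M hM hc Φ hlo hΛ hK hν hn hwin hΦw hU hT hs hst htT x ζ hx hζ
  rw [hpair]
  refine (fs_pairing_le_of_phase_window W M hM hc Φ hlo hhi hΛ hβ hν₀ hK hν hn hodd hwin hΦw hU hT hs hst htT hphase x ζ' hx hζ' hsat).trans ?_
  exact mul_le_mul_of_nonneg_left (Real.sqrt_le_sqrt hloss) (by positivity)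

/-- **(fs) AT CARRIER PHASE 0 ON ALL WINDOWS, fast datum / slow test**: the maximum of the short-window constant (p712752) and of the phase-window
constant (p713747) bounds the pairing in loss currency for every `0 ≤ s < t ≤ Tw` with `cellField(s + ·) = cellField`. -/
theorem fs_pairing_le_at_phase_zero {k : ℕ} (W : LatticeShear.LatticeWord k) (M : ℝ) (hM : 0 < M) {c : ℝ} (hc : 0 < c)
    (Φ : ℝ → Torus.Visc4 (Fin 3) → Torus.Visc4 (Fin 3)) {lo hi Λ β ν₀ K : ℝ}
    (hlo : 0 < lo) (hhi : 1 ≤ hi) (hΛ : 1 < Λ) (hβ : 0 ≤ β) (hν₀ : ν₀ ≤ 1) (hK : 0 < K)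
    {ν : ℝ} (hν : ν ∈ Set.Ioo 0 ν₀) {n : ℕ} (hn : (⌈K / ν⌉₊ : ℝ) ≤ n) {𝔸 : Torus.Visc4 (Fin 3)}
    (hodd : Torus.OddSmall 𝔸 (ν * β)) (hwin : ∃ lam ∈ Set.Icc (1:ℝ) Λ, Torus.NearIso 𝔸 (ν * (lo / lam)) (ν * (hi * lam)))
    (hΦw : ∃ lam ∈ Set.Icc (1:ℝ) Λ, Torus.NearIso (Φ ν ((1 / ν) • 𝔸)) (lo / lam) (hi * lam))
    {Tw : ℝ} {U T : ℝ → ℝ → (V2 →L[ℝ] V2)}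
    (hU : Torus.IsPropagator Tw (cellField W M hM ν hν.1 n) ((1 / (n:ℝ) ^ 2) • 𝔸) U)
    (hT : Torus.IsPropagator Tw (fun _ _ => 0) ((1 / (n:ℝ) ^ 2) • (𝔸 + (c / ν) • Φ ν ((1 / ν) • 𝔸))) T)
    {s t : ℝ} (hs : 0 ≤ s) (hst : s < t) (htT : t ≤ Tw)
    (hphase : ∀ τ, cellField W M hM ν hν.1 n (s + τ) = cellField W M hM ν hν.1 n τ)
    (x ζ : V2) (hx : IsFast n x) (hζ : IsSlow n ζ) :
    |⟪U s t x - T s t x, ζ⟫_ℝ|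
      ≤ max (ν * Λ * (k + hi * Λ + β) / (c * lo))
          (2 * Real.sqrt (3 * k * (3 * k + Real.pi ^ 2 * (hi * Λ + β / 2)) * Λ ^ 2 * Real.exp (9 * (k:ℝ) ^ 2 * Λ ^ 2 / (4 * Real.pi ^ 4 * c * lo ^ 2))
            / (Real.pi ^ 4 * c * lo ^ 2) + 2))
        * Real.sqrt (lossFwd (T s t) x) * Real.sqrt (lossAdj (T s t) ζ) := by
  set C1 : ℝ := ν * Λ * (k + hi * Λ + β) / (c * lo) with hC1
  set C2 : ℝ := 2 * Real.sqrt (3 * k * (3 * k + Real.pi ^ 2 * (hi * Λ + β / 2)) * Λ ^ 2 * Real.exp (9 * (k:ℝ) ^ 2 * Λ ^ 2 / (4 * Real.pi ^ 4 * c * lo ^ 2))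
            / (Real.pi ^ 4 * c * lo ^ 2) + 2) with hC2
  have h1 : 0 ≤ Real.sqrt (lossFwd (T s t) x) := Real.sqrt_nonneg _
  have h2 : 0 ≤ Real.sqrt (lossAdj (T s t) ζ) := Real.sqrt_nonneg _
  by_cases hshort : 8 * Real.pi ^ 2 * loT lo Λ c ν n * ((n / 4 : ℕ) : ℝ) ^ 2 * (t - s) ≤ 1
  · have h := fs_pairing_le_of_short_window W M hM hc Φ hlo hhi hΛ hβ hν₀ hK hν hn hodd hwin hΦw hU hT hs hst htT x ζ hx hζ hshort
    refine h.trans ?_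
    exact mul_le_mul_of_nonneg_right (mul_le_mul_of_nonneg_right (le_max_left C1 C2) h1) h2
  · have h := fs_pairing_le_of_phase_window_slow W M hM hc Φ hlo hhi hΛ hβ hν₀ hK hν hn hodd hwin hΦw hU hT hs hst htT hphase x ζ hx hζ
      (le_of_lt (not_le.1 hshort))
    refine h.trans ?_
    exact mul_le_mul_of_nonneg_right (mul_le_mul_of_nonneg_right (le_max_right C1 C2) h1) h2

end Summit.AnomalousDissipation.AnomalousDissipation.Theorems.SolenoidalFractalHomogenisation.LagrangianStep.VmodFlat

end
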